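import Summits.AtomisticToContinuum.Crystallization.Theorems.ReggeStarCoercivityStabilityConstantTwelve

/-!
# Route `ReggeStarCoercivity`, crux `StabilityConstantTwelve` (stmt-AtomisticToContinuum-13601) —
# the hybrid certificate's own constant: `E(N) ≥ -0.9470445076·N` (`B_LJ ≤ 11.3646 ε`)

Supporting file for the CLOSED item stmt-AtomisticToContinuum-13601 (`stabilityConstantTwelve_proof`,
`E(N) ≥ -N`, i.e. `B_LJ ≤ 12 ε`).  The tree's composition `StabilityConstantTwelve_of` feeds the
certificate value `g(0) = -c₁uₛ + Σ_q b_q = 2367611269/1250000000 = 1.8940890152` only through the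
rounded bound `g(0) ≤ 2` (`stub_cert_numeric`, `stub_reduction`).  This file records the SAME hybrid
two-point certificate (Hermite dipole + one-crossing Gaussian mixture, data of
`ReggeStarCoercivityStabilityConstantTwelveStubCertNumeric.lean`) at its exact value:

* `minorant_reduction_sharp` — Fisher–Ruelle / Cohn–Kumar zero-pressure reduction with the constant
  kept: a positive-definite-in-sum minorant `g ≤ V_LJ` gives `𝓔_N(x) ≥ -(g 0 / 2)·N`
  (the tree's `stub_reduction` is the `g 0 ≤ 2` specialisation; same proof);
* `cert_numeric_sharp` — the data of `stub_cert_numeric` with last conjunct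
  `-c₁uₛ + Σ b_q ≤ 2367611269/1250000000` (exact) instead of `≤ 2` (same region lemmas
  `certNumeric_region{A,B,C}`);
* `exists_minorant_of_cert` — the body of `StabilityConstantTwelve_of` with the bound on `g 0` a
  parameter `C`;
* `hybrid_stability`, `hybrid_groundStateEnergy_ge` — `Σ_{i<j} V_LJ ≥ -(2367611269/2500000000)·N`
  for distinct points, and `E(N) ≥ -0.9470445076·N`.

Context (tree, 2026-08-16): this constant is NOT the best certified one — the pure two-cone LP
witnesses give `E(N) ≥ -0.936518·N` (`TwoConeBound.twoCone_groundStateEnergy_ge`, `B_LJ ≤ 11.2382 ε`)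
and `E(N) ≥ -0.786477·N` (`TwoConeSA.twoConeS_groundStateEnergy_ge`, `B_LJ ≤ 9.4377 ε`); printed:
Yuhjtman 2015, Thm 9, `14.316 ε` (`Yuhjtman2015_stabilityConstant_holds`).  The point of this file is
only that every number quoted for the HYBRID certificate (publication bundle
`papers/AtomisticToContinuum/blj-12eps`, formerly the hand package `LJStability`, decls
`Main.lean:103–248`, `Reduction.lean:33`, `CertNumeric.lean:147`) is a tree theorem, so that the
bundle's Lean can be a generated enclosure of the tree (enclose rule, 2026-08-18).
-/

noncomputable section

namespace Summit.AtomisticToContinuum.Crystallization.Theorems.HybridCertificate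

open MeasureTheory Set Real
open scoped Nat
open Literature.MathematicalPhysics.StatisticalMechanics
open Summit.AtomisticToContinuum.Crystallization.Theorems

/-- Two-point minorant reduction, sharp form (Fisher–Ruelle / Cohn–Kumar Prop. 9.3 at zero
pressure, finite form, constant kept): a positive-definite-in-sum minorant `g` of `V_LJ` (as a
function of the squared distance, `g(r²) ≤ V_LJ(r)` for `r > 0`) gives `𝓔_N(x) ≥ -(g 0 / 2)·N` for
every configuration of `N` distinct points in `ℝ³`:
`2 𝓔_N(x) = Σ_i Σ_{k≠i} V_LJ ≥ Σ_{i,k} g - N g(0) ≥ -N g(0)`.  (`stub_reduction` = case `g 0 ≤ 2`.)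
[folklore] -/
theorem minorant_reduction_sharp (g : ℝ → ℝ)
    (hpd : ∀ (N : ℕ) (x : Fin N → EuclideanSpace ℝ (Fin 3)), 0 ≤ ∑ i, ∑ j, g (‖x i - x j‖ ^ 2))
    (hle : ∀ r : ℝ, 0 < r → g (r ^ 2) ≤ lennardJones r)
    (N : ℕ) (x : Fin N → EuclideanSpace ℝ (Fin 3)) (hx : Function.Injective x) :
    -(g 0 / 2 * N) ≤ interactionEnergy lennardJones x := by
  -- off-diagonal pairs: distinct points are at positive distance, so the minorant applies
  have hoff : ∀ i k : Fin N, k ≠ i → g (‖x i - x k‖ ^ 2) ≤ lennardJones (dist (x i) (x k)) := by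
    intro i k hki
    have hne : x i - x k ≠ 0 := sub_ne_zero.2 fun h => hki (hx h).symm
    rw [dist_eq_norm]
    exact hle _ (norm_pos_iff.2 hne)
  -- per site: `Σ_k g(|x_i - x_k|²) - g 0 ≤ 𝓔ⁱ(x)`
  have hsite : ∀ i : Fin N,
      ∑ k, g (‖x i - x k‖ ^ 2) - g 0 ≤ siteEnergy lennardJones x i := by
    intro i
    unfold siteEnergy
    calc ∑ k, g (‖x i - x k‖ ^ 2) - g 0
          = ∑ k ∈ Finset.univ.erase i, g (‖x i - x k‖ ^ 2) := by
            rw [Finset.sum_erase_eq_sub (Finset.mem_univ i)]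
            simp
      _ ≤ ∑ k ∈ Finset.univ.erase i, lennardJones (dist (x i) (x k)) :=
            Finset.sum_le_sum fun k hk => hoff i k (Finset.ne_of_mem_erase hk)
  -- sum over sites and double counting
  have h2 : 2 * interactionEnergy lennardJones x = ∑ i, siteEnergy lennardJones x i :=
    two_mul_interactionEnergy lennardJones x
  have h3 : ∑ i, (∑ k, g (‖x i - x k‖ ^ 2) - g 0) ≤ ∑ i, siteEnergy lennardJones x i :=
    Finset.sum_le_sum fun i _ => hsite i
  rw [Finset.sum_sub_distrib, Finset.sum_const, Finset.card_univ, Fintype.card_fin,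
    nsmul_eq_mul] at h3
  have h4 : 0 ≤ ∑ i, ∑ k, g (‖x i - x k‖ ^ 2) := hpd N x
  linarith

/-- **The explicit hybrid certificate, exact value.** Same rational data as `stub_cert_numeric`
(`t₀ = 5/2`, `uₛ = 3/5`, `u₁ = 9/2`, `c₁ = -89283/31250`, `σ = 3`, `m = 4`, `n = 22`, `K = 5`,
`k = 4`, `b = (-121887/2500000000, -565583/100000000, 0, -22647/62500, 68489/125000)`), with the
last conjunct recording the exact value `-c₁ uₛ + Σ_q b_q = 2367611269/1250000000 = 1.8940890152`
(so `g(0)/2 = 0.9470445076`) instead of the rounded `≤ 2`. [folklore] -/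
theorem cert_numeric_sharp :
    ∃ (t₀ uₛ u₁ c₁ σ : ℝ) (m n K k : ℕ) (b : ℕ → ℝ),
      0 < t₀ ∧ c₁ ≤ 0 ∧ 3 / 2 ≤ t₀ * uₛ ∧ 0 < uₛ ∧ uₛ ≤ u₁ ∧ 2 * (t₀ * u₁) ≤ n + 1 ∧ 0 < σ ∧
      (∀ q, q < k → b q ≤ 0) ∧ (∀ q, k ≤ q → 0 ≤ b q) ∧
      (∃ q, q < k ∧ b q < 0) ∧ (∃ q, k ≤ q ∧ q < K ∧ 0 < b q) ∧
      0 ≤ ∑ q ∈ Finset.range K, b q * ((2 * q - 1)‼ : ℝ) / (2 ^ q * (q + 1)! : ℝ) ∧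
      (∀ r : ℝ, 0 < r → r ^ 2 ≤ uₛ →
        c₁ * (r ^ 2 - uₛ) / (∑ i ∈ Finset.range (m + 1), (t₀ * r ^ 2) ^ i / (i ! : ℝ)) +
          (∑ q ∈ Finset.range K, b q * (σ / (σ + r ^ 2)) ^ (q + 2)) ≤ lennardJones r) ∧
      (∀ r : ℝ, 0 < r → uₛ ≤ r ^ 2 → r ^ 2 ≤ u₁ →
        c₁ * (r ^ 2 - uₛ) /
            (∑ i ∈ Finset.range n, (t₀ * r ^ 2) ^ i / (i ! : ℝ) + (t₀ * r ^ 2) ^ n / (n ! : ℝ) * 2) +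
          (∑ q ∈ Finset.range K, b q * (σ / (σ + r ^ 2)) ^ (q + 2)) ≤ lennardJones r) ∧
      (∀ r : ℝ, 0 < r → u₁ ≤ r ^ 2 →
        (∑ q ∈ Finset.range K, b q * (σ / (σ + r ^ 2)) ^ (q + 2)) ≤ lennardJones r) ∧
      -(c₁ * uₛ) + (∑ q ∈ Finset.range K, b q) ≤ 2367611269 / 1250000000 := by
  refine ⟨(5:ℝ) / 2, (3:ℝ) / 5, (9:ℝ) / 2, (-((89283 : ℝ) / 31250)), 3, 4, 22, 5, 4, (fun q : ℕ => if q = 0 then (-((121887 : ℝ) / 2500000000)) else if q = 1 then (-((565583 : ℝ) / 100000000)) else if q = 2 then (0 : ℝ) else if q = 3 then (-((22647 : ℝ) / 62500)) else if q = 4 then ((68489 : ℝ) / 125000) else 0),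
    by norm_num, by norm_num, by norm_num, by norm_num, by norm_num, by norm_num, by norm_num,
    ?_, ?_, ⟨0, by norm_num, by norm_num⟩, ⟨4, le_rfl, by norm_num, by norm_num⟩, ?_,
    fun r hr h => certNumeric_regionA r hr h, fun r hr h1 h2 => certNumeric_regionB r hr h1 h2,
    fun r hr h => certNumeric_regionC r hr h, ?_⟩
  · intro q hq
    interval_cases q <;> norm_num
  · intro q hq
    by_cases h4 : q = 4
    · subst h4; norm_num
    · have h0 : q ≠ 0 := by omega
      have h1 : q ≠ 1 := by omega
      have h2 : q ≠ 2 := by omega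
      have h3 : q ≠ 3 := by omega
      simp [h0, h1, h2, h3, h4]
  · simp [Finset.sum_range_succ, Nat.doubleFactorial, Nat.factorial]
    norm_num
  · simp [Finset.sum_range_succ]
    norm_num

/-- **From certificate data to a two-point minorant.** Rational data of the shape produced by
`cert_numeric_sharp` / `stub_cert_numeric`, with an arbitrary bound `C` on `-c₁ uₛ + Σ b_q`, yield a
function `g` of the squared distance that is positive definite in sum on `ℝ³` (one-crossing engine
`stub_engine` against `stub_gaussSum_mono`, plus the Hermite dipole `stub_hermite_pd`), lies below
`V_LJ` (three regions, Taylor envelopes `exp_neg_le_inv_taylor` / `exp_le_taylor_add`), and has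
`g 0 ≤ C`.  This is the body of `StabilityConstantTwelve_of` with the constant made a parameter.
[folklore] -/
theorem exists_minorant_of_cert {C : ℝ}
    (hcert : ∃ (t₀ uₛ u₁ c₁ σ : ℝ) (m n K k : ℕ) (b : ℕ → ℝ),
      0 < t₀ ∧ c₁ ≤ 0 ∧ 3 / 2 ≤ t₀ * uₛ ∧ 0 < uₛ ∧ uₛ ≤ u₁ ∧ 2 * (t₀ * u₁) ≤ n + 1 ∧ 0 < σ ∧
      (∀ q, q < k → b q ≤ 0) ∧ (∀ q, k ≤ q → 0 ≤ b q) ∧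
      (∃ q, q < k ∧ b q < 0) ∧ (∃ q, k ≤ q ∧ q < K ∧ 0 < b q) ∧
      0 ≤ ∑ q ∈ Finset.range K, b q * ((2 * q - 1)‼ : ℝ) / (2 ^ q * (q + 1)! : ℝ) ∧
      (∀ r : ℝ, 0 < r → r ^ 2 ≤ uₛ →
        c₁ * (r ^ 2 - uₛ) / (∑ i ∈ Finset.range (m + 1), (t₀ * r ^ 2) ^ i / (i ! : ℝ)) +
          (∑ q ∈ Finset.range K, b q * (σ / (σ + r ^ 2)) ^ (q + 2)) ≤ lennardJones r) ∧
      (∀ r : ℝ, 0 < r → uₛ ≤ r ^ 2 → r ^ 2 ≤ u₁ →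
        c₁ * (r ^ 2 - uₛ) /
            (∑ i ∈ Finset.range n, (t₀ * r ^ 2) ^ i / (i ! : ℝ) + (t₀ * r ^ 2) ^ n / (n ! : ℝ) * 2) +
          (∑ q ∈ Finset.range K, b q * (σ / (σ + r ^ 2)) ^ (q + 2)) ≤ lennardJones r) ∧
      (∀ r : ℝ, 0 < r → u₁ ≤ r ^ 2 →
        (∑ q ∈ Finset.range K, b q * (σ / (σ + r ^ 2)) ^ (q + 2)) ≤ lennardJones r) ∧
      -(c₁ * uₛ) + (∑ q ∈ Finset.range K, b q) ≤ C) :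
    ∃ g : ℝ → ℝ,
      (∀ (N : ℕ) (x : Fin N → EuclideanSpace ℝ (Fin 3)), 0 ≤ ∑ i, ∑ j, g (‖x i - x j‖ ^ 2)) ∧
      (∀ r : ℝ, 0 < r → g (r ^ 2) ≤ lennardJones r) ∧ g 0 ≤ C := by
  obtain ⟨t₀, uₛ, u₁, c₁, σ, m, n, K, k, b, ht₀, hc₁, hpd0, huₛ, hu₁, hn, hσ, hneg, hpos, hex_neg,
    hex_pos, hmass, hA, hB, hC, hval⟩ := hcert
  -- the rational piece: density and Gaussian mixture
  set a : ℝ → ℝ := fun t => Real.exp (-(σ * t)) *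
      ∑ q ∈ Finset.range K, b q * σ ^ (q + 2) * t ^ (q + 1) / ((q + 1)! : ℝ) with ha_def
  set R : ℝ → ℝ := fun u => ∑ q ∈ Finset.range K, b q * (σ / (σ + u)) ^ (q + 2) with hR_def
  -- the Hermite piece and the full certificate
  set h : ℝ → ℝ := fun u => c₁ * (u - uₛ) * Real.exp (-(t₀ * u)) with hh_def
  set g : ℝ → ℝ := fun u => h u + R u with hg_def
  obtain ⟨ha_int, ha_int', ha_mass, ha_repr⟩ := stub_cert_analytic σ hσ K b a ha_def
  obtain ⟨t₁, ht₁, ha_neg, ha_pos⟩ :=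
    stub_cert_crossing σ hσ K k b hneg hpos hex_neg hex_pos a ha_def
  have hmass' : 0 ≤ ∫ t in Ioi 0, a t * t ^ (-(3 / 2 : ℝ)) := by
    rw [ha_mass]
    have h1 : 0 ≤ σ ^ ((3 : ℝ) / 2) := by positivity
    have h2 : 0 ≤ √π := Real.sqrt_nonneg _
    exact mul_nonneg (mul_nonneg h1 h2) hmass
  -- positive definiteness in sum of both pieces
  have hpdR : ∀ (N : ℕ) (x : Fin N → EuclideanSpace ℝ (Fin 3)),
      0 ≤ ∑ i, ∑ j, R (‖x i - x j‖ ^ 2) := by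
    intro N x
    have hrw : ∀ i j : Fin N, R (‖x i - x j‖ ^ 2) =
        ∫ t in Ioi 0, Real.exp (-(t * ‖x i - x j‖ ^ 2)) * a t := fun i j =>
      (ha_repr _ (sq_nonneg _)).symm
    simp_rw [hrw]
    exact stub_engine a t₁ ht₁ ha_neg ha_pos ha_int ha_int' hmass'
      (fun N x t₁ t₂ h₁ h₁₂ => stub_gaussSum_mono N x h₁ h₁₂) N x
  have hpd : ∀ (N : ℕ) (x : Fin N → EuclideanSpace ℝ (Fin 3)),
      0 ≤ ∑ i, ∑ j, g (‖x i - x j‖ ^ 2) := by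
    intro N x
    have hsplit : ∑ i, ∑ j, g (‖x i - x j‖ ^ 2) =
        (∑ i, ∑ j, c₁ * (‖x i - x j‖ ^ 2 - uₛ) * Real.exp (-(t₀ * ‖x i - x j‖ ^ 2))) +
          ∑ i, ∑ j, R (‖x i - x j‖ ^ 2) := by
      rw [← Finset.sum_add_distrib]
      refine Finset.sum_congr rfl fun i _ => ?_
      rw [← Finset.sum_add_distrib]
    rw [hsplit]
    exact add_nonneg (stub_hermite_pd t₀ uₛ c₁ ht₀ hc₁ hpd0 N x) (hpdR N x)
  -- the minorant inequality, by regions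
  have hle : ∀ r : ℝ, 0 < r → g (r ^ 2) ≤ lennardJones r := by
    intro r hr
    have hx0 : 0 ≤ t₀ * r ^ 2 := by positivity
    show h (r ^ 2) + R (r ^ 2) ≤ lennardJones r
    rcases le_or_gt (r ^ 2) uₛ with hAu | hBu
    · -- region A: `c₁ (u - uₛ) ≥ 0`, envelope from above
      have hfac : 0 ≤ c₁ * (r ^ 2 - uₛ) := mul_nonneg_of_nonpos_of_nonpos hc₁ (by linarith)
      have hT : 0 < ∑ i ∈ Finset.range (m + 1), (t₀ * r ^ 2) ^ i / (i ! : ℝ) := by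
        rw [Finset.sum_range_succ']
        have : 0 ≤ ∑ i ∈ Finset.range m, (t₀ * r ^ 2) ^ (i + 1) / ((i + 1)! : ℝ) :=
          Finset.sum_nonneg fun i _ => by positivity
        simpa using by positivity
      have henv := exp_neg_le_inv_taylor hx0 m
      have hh : h (r ^ 2) ≤
          c₁ * (r ^ 2 - uₛ) / ∑ i ∈ Finset.range (m + 1), (t₀ * r ^ 2) ^ i / (i ! : ℝ) := by
        show c₁ * (r ^ 2 - uₛ) * Real.exp (-(t₀ * r ^ 2)) ≤ _
        rw [div_eq_mul_one_div]
        exact mul_le_mul_of_nonneg_left henv hfac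
      linarith [hA r hr hAu]
    rcases le_or_gt (r ^ 2) u₁ with hBu' | hCu
    · -- region B: `c₁ (u - uₛ) ≤ 0`, envelope from below
      have hfac : c₁ * (r ^ 2 - uₛ) ≤ 0 := mul_nonpos_of_nonpos_of_nonneg hc₁ (by linarith)
      have hxn : 2 * (t₀ * r ^ 2) ≤ n + 1 := by nlinarith
      have hup := exp_le_taylor_add hx0 hxn
      set T := ∑ i ∈ Finset.range n, (t₀ * r ^ 2) ^ i / (i ! : ℝ) + (t₀ * r ^ 2) ^ n / (n ! : ℝ) * 2
        with hT_def
      have hTpos : 0 < T := (Real.exp_pos _).trans_le hup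
      have henv : 1 / T ≤ Real.exp (-(t₀ * r ^ 2)) := by
        rw [Real.exp_neg, ← one_div]
        exact one_div_le_one_div_of_le (Real.exp_pos _) hup
      have hh : h (r ^ 2) ≤ c₁ * (r ^ 2 - uₛ) / T := by
        show c₁ * (r ^ 2 - uₛ) * Real.exp (-(t₀ * r ^ 2)) ≤ _
        rw [div_eq_mul_one_div]
        exact mul_le_mul_of_nonpos_left henv hfac
      linarith [hB r hr hBu.le hBu']
    · -- region C: `h ≤ 0`
      have hh : h (r ^ 2) ≤ 0 := by
        show c₁ * (r ^ 2 - uₛ) * Real.exp (-(t₀ * r ^ 2)) ≤ 0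
        exact mul_nonpos_of_nonpos_of_nonneg
          (mul_nonpos_of_nonpos_of_nonneg hc₁ (by linarith)) (Real.exp_pos _).le
      linarith [hC r hr hCu.le]
  have hg0 : g 0 ≤ C := by
    have hR0 : R 0 = ∑ q ∈ Finset.range K, b q := by
      rw [hR_def]
      refine Finset.sum_congr rfl fun q _ => ?_
      rw [add_zero, div_self hσ.ne', one_pow, mul_one]
    have hh0 : h 0 = -(c₁ * uₛ) := by
      show c₁ * (0 - uₛ) * Real.exp (-(t₀ * 0)) = -(c₁ * uₛ)
      rw [mul_zero, neg_zero, Real.exp_zero]; ring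
    show h 0 + R 0 ≤ C
    rw [hh0, hR0]; exact hval
  exact ⟨g, hpd, hle, hg0⟩

/-- **Hybrid-certificate stability bound, configuration form.** For every configuration of `N`
distinct points in `ℝ³`, `Σ_{i<j} V_LJ(|x_i - x_j|) ≥ -(2367611269/2500000000)·N = -0.9470445076·N`.
[folklore] -/
theorem hybrid_stability (N : ℕ) (x : Fin N → EuclideanSpace ℝ (Fin 3))
    (hx : Function.Injective x) :
    -(2367611269 / 2500000000 * (N : ℝ)) ≤ interactionEnergy lennardJones x := by
  obtain ⟨g, hpd, hle, hg0⟩ := exists_minorant_of_cert cert_numeric_sharp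
  have h := minorant_reduction_sharp g hpd hle N x hx
  have h5 : g 0 / 2 * (N : ℝ) ≤ 2367611269 / 2500000000 * N :=
    mul_le_mul_of_nonneg_right (by linarith) (Nat.cast_nonneg N)
  linarith

/-- **Hybrid-certificate stability bound, ground-state form**: `E(N) ≥ -0.9470445076·N` for every
`N`, i.e. `B_LJ ≤ 11.3646 ε` by this certificate (the tree's `TwoConeSA.twoConeS_groundStateEnergy_ge`
gives the sharper `9.4377 ε`). [folklore] -/
theorem hybrid_groundStateEnergy_ge (N : ℕ) :
    -(2367611269 / 2500000000 * (N : ℝ)) ≤ groundStateEnergy lennardJones 3 N := by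
  haveI := nonempty_injective_config (d := 3) (by norm_num) N
  exact le_ciInf fun y => hybrid_stability N y.1 y.2

end Summit.AtomisticToContinuum.Crystallization.Theorems.HybridCertificate

end
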